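import Summits.KontsevichZagierPeriods.Zeta5Search.Certificates.RecordRayDenominatorsCellsC
import Summits.KontsevichZagierPeriods.Zeta5Search.Certificates.RecordRayDenominatorsLawWWindows
import HarnessLib

/-!
# ζ(5) search — the record ray's DENOMINATORS, IX: the 24-window atlas and the hypothesis-free exponent `0.5525` (TYPER g15)

HONEST FRAMING: systematic search; no irrationality claim unless certified.

OUR work (Summit side; typer seat, generation 15).  The atlas of file VII (20 windows: 4 big-prime windows of file IV and
16 record-cell windows of files VI-a/b/c, rate `389293 / 1560`) extended by the four `(WV)`-law windows of file VIII
(`(12n,13n]`, `(13n,14n]`, `(14n,15n]` with exponent `1`, `(15n,16n]` with exponent `3`; rate `+6`).  Tables `AZx, BZx, wQx`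
(endpoints × 4680, exponents); `Φ_n = ∏_i (∏_{A_i n < p ≤ B_i n} p)^{k_i}`, `MX n = M0 n / Φ_n`: `MX·P_n ∈ ℤ`, `MX·Q(a·n) ∈ ℤ`
(`multiWindowProd_dvd_int`, window by window), `Φ_n ≥ e^{(398653 / 1560 − ε)n}` by the prime number theorem
(`Σ k_i(B_i − A_i) = 398653 / 1560 = 255.5468`), so `MX n ≤ e^{(125.9764 + ε)n}` and

* `record_exponent_lawW` — **hypothesis-free: for every `0 ≤ γ ≤ 0.5525`, eventually `|ζ(5) − P_n/Q(a·n)| < 1/q_n^γ`** with the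
  integers `p_n = MX n·P_n`, `q_n = MX n·|Q(a·n)|` (file IV: `0.4949`; file VII: `0.536`; Brown–Zudilin print `0.86` from the
  observed laws (28)–(30), `0.5` being their proved-denominator figure is not claimed here either way).

No irrationality content (`γ < 1`).
-/

noncomputable section

open Finset Real Filter Topology

namespace Summit.KontsevichZagierPeriods.Zeta5Search.RecordRay

open Summit.KontsevichZagierPeriods.Zeta5Search.DualSeries
open Summit.KontsevichZagierPeriods.Zeta5Search.DualSeriesDenominators
open Summit.KontsevichZagierPeriods.Zeta5Search.WedgeDictionary
open Summit.KontsevichZagierPeriods.Zeta5Search.DualSeriesLemma19 (bRecord)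
open Literature.NumberTheory.Irrationality.Hata1992
open Literature.NumberTheory.Transcendental (zetaValue)

/-- Left endpoints of the 24 windows, times `4680` (integers; window `i` is `(AZx i/4680 · n, BZx i/4680 · n]`). -/
def AZx : Fin 24 → ℕ := ![74880, 79560, 84240, 117000, 8840, 9360, 14040, 18720, 19188, 19500, 21060, 21840, 23400, 25740, 26520, 28080, 29250, 37440, 38376, 39000, 56160, 60840, 65520, 70200]

/-- Right endpoints of the 24 windows, times `4680`. -/
def BZx : Fin 24 → ℕ := ![79560, 84240, 117000, 191880, 9000, 9750, 14625, 19188, 19500, 19890, 21840, 23400, 24960, 26520, 28080, 29250, 29640, 38376, 39000, 39780, 60840, 65520, 70200, 74880]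

/-- Exponents removed on the 24 windows. -/
def wQx : Fin 24 → ℕ := ![8, 9, 10, 9, 6, 7, 7, 9, 8, 8, 7, 4, 5, 9, 9, 9, 8, 7, 6, 6, 1, 1, 1, 3]

/-- Left endpoints as reals. -/
def AwinX (i : Fin 24) : ℝ := (AZx i : ℝ) / 4680

/-- Right endpoints as reals. -/
def BwinX (i : Fin 24) : ℝ := (BZx i : ℝ) / 4680

/-- The windows are genuine intervals (integer table, by evaluation). -/
theorem AZx_le_BZx : ∀ i : Fin 24, AZx i ≤ BZx i := by decide

/-- The windows are pairwise separated (integer table, by evaluation). -/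
theorem windowsX_separated : ∀ i j : Fin 24, i ≠ j → BZx i ≤ AZx j ∨ BZx j ≤ AZx i := by decide

/-- `Σ_i k_i (BZ_i − AZ_i) = 1195959` (`= 4680 · 398653 / 1560`; integer table, by evaluation). -/
theorem window_rateZx : ∑ i : Fin 24, wQx i * (BZx i - AZx i) = 1195959 := by decide

/-- The window factor `Φ_n`. -/
def corrX (n : ℕ) : ℕ := multiWindowProd Finset.univ AwinX BwinX wQx n

/-- **The multiplier** `MX n = M0 n / Φ_n`. -/
def MX (n : ℕ) : ℚ := M0 n / (corrX n : ℚ)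

/-- `Φ_n > 0`. -/
theorem corrX_pos (n : ℕ) : 0 < corrX n := multiWindowProd_pos _ _ _ _ _

/-- `0 < MX n`. -/
theorem MX_pos (n : ℕ) : 0 < MX n := div_pos (M0_pos n) (by exact_mod_cast corrX_pos n)

/-- `0 ≤ A_i ≤ B_i` over `ℝ`. -/
theorem AwinX_le_BwinX : ∀ i ∈ (Finset.univ : Finset (Fin 24)), 0 ≤ AwinX i ∧ AwinX i ≤ BwinX i := by
  intro i _
  have h : (AZx i : ℝ) ≤ BZx i := by exact_mod_cast AZx_le_BZx i
  refine ⟨by unfold AwinX; positivity, ?_⟩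
  unfold AwinX BwinX
  exact div_le_div_of_nonneg_right h (by norm_num)

/-- `Σ_i k_i (B_i − A_i) = 398653 / 1560` over `ℝ`. -/
theorem window_rateX : ∑ i ∈ (Finset.univ : Finset (Fin 24)), (wQx i : ℝ) * (BwinX i - AwinX i) = 398653 / 1560 := by
  have h : ∀ i : Fin 24, (wQx i : ℝ) * (BwinX i - AwinX i) = ((wQx i * (BZx i - AZx i) : ℕ) : ℝ) / 4680 := by
    intro i
    have hle := AZx_le_BZx i
    unfold AwinX BwinX
    push_cast [Nat.cast_sub hle]
    ring
  rw [Finset.sum_congr rfl fun i _ => h i, ← Finset.sum_div]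
  have hz : ((∑ i : Fin 24, wQx i * (BZx i - AZx i) : ℕ) : ℝ) = 1195959 := by exact_mod_cast window_rateZx
  rw [← Nat.cast_sum, hz]
  norm_num

/-- A prime of window `i`: prime, `A_i n < p ≤ B_i n`. -/
theorem windowX_prime {n : ℕ} {i : Fin 24} {p : ℕ} (hp : p ∈ windowPrimes (AwinX i) (BwinX i) n) :
    p.Prime ∧ AwinX i * n < p ∧ (p : ℝ) ≤ BwinX i * n :=
  (mem_windowPrimes_iff (AwinX_le_BwinX i (Finset.mem_univ _)).1).1 hp

/-- The windows are pairwise disjoint. -/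
theorem windowsX_disjoint (n : ℕ) : ∀ i ∈ (Finset.univ : Finset (Fin 24)), ∀ j ∈ (Finset.univ : Finset (Fin 24)), i ≠ j →
    Disjoint (windowPrimes (AwinX i) (BwinX i) n) (windowPrimes (AwinX j) (BwinX j) n) := by
  intro i _ j _ hij
  rw [Finset.disjoint_left]
  intro p hpi hpj
  obtain ⟨-, a1, b1⟩ := windowX_prime hpi
  obtain ⟨-, a2, b2⟩ := windowX_prime hpj
  have hn : (0 : ℝ) ≤ n := Nat.cast_nonneg n
  rcases windowsX_separated i j hij with h | h
  · have h' : BwinX i ≤ AwinX j := by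
      unfold AwinX BwinX; exact div_le_div_of_nonneg_right (by exact_mod_cast h) (by norm_num)
    nlinarith [mul_le_mul_of_nonneg_right h' hn]
  · have h' : BwinX j ≤ AwinX i := by
      unfold AwinX BwinX; exact div_le_div_of_nonneg_right (by exact_mod_cast h) (by norm_num)
    nlinarith [mul_le_mul_of_nonneg_right h' hn]

/-- An old window (files VI-a/b/c): the same endpoints in the 20-window tables. -/
theorem win_conv {i : Fin 24} {j : Fin 20} (hA : AZx i = AZw j) (hB : BZx i = BZw j) {n p : ℕ}
    (h1 : AwinX i * n < p) (h2 : (p : ℝ) ≤ BwinX i * n) : AwinW j * n < p ∧ (p : ℝ) ≤ BwinW j * n := by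
  unfold AwinX at h1; unfold BwinX at h2
  unfold AwinW BwinW
  rw [← hA, ← hB]
  exact ⟨h1, h2⟩

/-- A new window with integer endpoints `(A n, B n]`. -/
theorem win_convN {i : Fin 24} {A B : ℕ} (hA : AZx i = A * 4680) (hB : BZx i = B * 4680) {n p : ℕ}
    (h1 : AwinX i * n < p) (h2 : (p : ℝ) ≤ BwinX i * n) : A * n < p ∧ p ≤ B * n := by
  unfold AwinX at h1; unfold BwinX at h2
  have eA : ((A * 4680 : ℕ) : ℝ) / 4680 = A := by push_cast; ring
  have eB : ((B * 4680 : ℕ) : ℝ) / 4680 = B := by push_cast; ring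
  rw [hA, eA] at h1
  rw [hB, eB] at h2
  constructor
  · have h' : ((A * n : ℕ) : ℝ) < p := by push_cast; exact h1
    exact_mod_cast h'
  · have h' : (p : ℝ) ≤ ((B * n : ℕ) : ℝ) := by push_cast; exact h2
    exact_mod_cast h'

/-- **The window divisibilities** (`n ≥ 42`): for every window `i` and every prime `p` in it, `p^{k_i}` divides the multiplied
wedge and the multiplied Q-minor. -/
theorem windowsX_dvd {n : ℕ} (hn : 42 ≤ n)
    {zW zV zW' zV' zU zU' : ℤ}
    (hzW : dRec n ^ 3 * sharpNormaliser (bRecord n) * coeffW (bRecord n) = zW)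
    (hzV : dRec n ^ 6 * sharpNormaliser (bRecord n) * coeffV (bRecord n) = zV)
    (hzW' : dRec n ^ 3 * sharpNormaliser (bRecord' n) * coeffW (bRecord' n) = zW')
    (hzV' : dRec n ^ 6 * sharpNormaliser (bRecord' n) * coeffV (bRecord' n) = zV')
    (hzU : dRec n * sharpNormaliser (bRecord n) * coeffU (bRecord n) = zU)
    (hzU' : dRec n * sharpNormaliser (bRecord' n) * coeffU (bRecord' n) = zU') :
    ∀ i ∈ (Finset.univ : Finset (Fin 24)), ∀ p ∈ windowPrimes (AwinX i) (BwinX i) n,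
      ((p : ℤ) ^ wQx i ∣ (zW' * zV - zW * zV')) ∧
      ((p : ℤ) ^ wQx i ∣ ((Nat.lcmUpto (41 * n) : ℤ) ^ 5 * (zU * zW') - (Nat.lcmUpto (41 * n) : ℤ) ^ 5 * (zU' * zW))) := by
  intro i _ p hp
  obtain ⟨hpr, h1, h2⟩ := windowX_prime hp
  fin_cases i
  · obtain ⟨h1', h2'⟩ := win_conv (j := 0) (by decide) (by decide) h1 h2
    exact wBig0 hn hpr h1' h2' hzW hzV hzW' hzV' hzU hzU'
  · obtain ⟨h1', h2'⟩ := win_conv (j := 1) (by decide) (by decide) h1 h2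
    exact wBig1 hn hpr h1' h2' hzW hzV hzW' hzV' hzU hzU'
  · obtain ⟨h1', h2'⟩ := win_conv (j := 2) (by decide) (by decide) h1 h2
    exact wBig2 hn hpr h1' h2' hzW hzV hzW' hzV' hzU hzU'
  · obtain ⟨h1', h2'⟩ := win_conv (j := 3) (by decide) (by decide) h1 h2
    exact wBig3 hn hpr h1' h2' hzW hzV hzW' hzV' hzU hzU'
  · obtain ⟨h1', h2'⟩ := win_conv (j := 4) (by decide) (by decide) h1 h2
    exact wCell0 hn hpr h1' h2' hzW hzV hzW' hzV' hzU hzU'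
  · obtain ⟨h1', h2'⟩ := win_conv (j := 5) (by decide) (by decide) h1 h2
    exact wCell1 hn hpr h1' h2' hzW hzV hzW' hzV' hzU hzU'
  · obtain ⟨h1', h2'⟩ := win_conv (j := 6) (by decide) (by decide) h1 h2
    exact wCell2 hn hpr h1' h2' hzW hzV hzW' hzV' hzU hzU'
  · obtain ⟨h1', h2'⟩ := win_conv (j := 7) (by decide) (by decide) h1 h2
    exact wCell3 hn hpr h1' h2' hzW hzV hzW' hzV' hzU hzU'
  · obtain ⟨h1', h2'⟩ := win_conv (j := 8) (by decide) (by decide) h1 h2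
    exact wCell4 hn hpr h1' h2' hzW hzV hzW' hzV' hzU hzU'
  · obtain ⟨h1', h2'⟩ := win_conv (j := 9) (by decide) (by decide) h1 h2
    exact wCell5 hn hpr h1' h2' hzW hzV hzW' hzV' hzU hzU'
  · obtain ⟨h1', h2'⟩ := win_conv (j := 10) (by decide) (by decide) h1 h2
    exact wCell6 hn hpr h1' h2' hzW hzV hzW' hzV' hzU hzU'
  · obtain ⟨h1', h2'⟩ := win_conv (j := 11) (by decide) (by decide) h1 h2
    exact wCell7 hn hpr h1' h2' hzW hzV hzW' hzV' hzU hzU'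
  · obtain ⟨h1', h2'⟩ := win_conv (j := 12) (by decide) (by decide) h1 h2
    exact wCell8 hn hpr h1' h2' hzW hzV hzW' hzV' hzU hzU'
  · obtain ⟨h1', h2'⟩ := win_conv (j := 13) (by decide) (by decide) h1 h2
    exact wCell9 hn hpr h1' h2' hzW hzV hzW' hzV' hzU hzU'
  · obtain ⟨h1', h2'⟩ := win_conv (j := 14) (by decide) (by decide) h1 h2
    exact wCell10 hn hpr h1' h2' hzW hzV hzW' hzV' hzU hzU'
  · obtain ⟨h1', h2'⟩ := win_conv (j := 15) (by decide) (by decide) h1 h2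
    exact wCell11 hn hpr h1' h2' hzW hzV hzW' hzV' hzU hzU'
  · obtain ⟨h1', h2'⟩ := win_conv (j := 16) (by decide) (by decide) h1 h2
    exact wCell12 hn hpr h1' h2' hzW hzV hzW' hzV' hzU hzU'
  · obtain ⟨h1', h2'⟩ := win_conv (j := 17) (by decide) (by decide) h1 h2
    exact wCell13 hn hpr h1' h2' hzW hzV hzW' hzV' hzU hzU'
  · obtain ⟨h1', h2'⟩ := win_conv (j := 18) (by decide) (by decide) h1 h2
    exact wCell14 hn hpr h1' h2' hzW hzV hzW' hzV' hzU hzU'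
  · obtain ⟨h1', h2'⟩ := win_conv (j := 19) (by decide) (by decide) h1 h2
    exact wCell15 hn hpr h1' h2' hzW hzV hzW' hzV' hzU hzU'
  · obtain ⟨hloN, hhiN⟩ := win_convN (A := 12) (B := 13) (by decide) (by decide) h1 h2
    exact wLaw0 hn hpr hloN hhiN hzW hzV hzW' hzV' hzU hzU'
  · obtain ⟨hloN, hhiN⟩ := win_convN (A := 13) (B := 14) (by decide) (by decide) h1 h2
    exact wLaw1 hn hpr hloN hhiN hzW hzV hzW' hzV' hzU hzU'
  · obtain ⟨hloN, hhiN⟩ := win_convN (A := 14) (B := 15) (by decide) (by decide) h1 h2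
    exact wLaw2 hn hpr hloN hhiN hzW hzV hzW' hzV' hzU hzU'
  · obtain ⟨hloN, hhiN⟩ := win_convN (A := 15) (B := 16) (by decide) (by decide) h1 h2
    exact wLaw3 hn hpr hloN hhiN hzW hzV hzW' hzV' hzU hzU'

/-- **`MX n · P_n ∈ ℤ`** (`n ≥ 42`). -/
theorem MX_mul_recordP_int {n : ℕ} (hn : 42 ≤ n) : ∃ z : ℤ, MX n * recordP n = z := by
  classical
  have hn1 : 1 ≤ n := by omega
  obtain ⟨⟨zU, hzU⟩, ⟨zW, hzW⟩, ⟨zV, hzV⟩, ⟨zU', hzU'⟩, ⟨zW', hzW'⟩, ⟨zV', hzV'⟩⟩ := sharp_ints hn1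
  obtain ⟨s, -, hρ⟩ := exists_sign_mul_abs _ (rhoOf_aRec_ne_zero n)
  have habs : |rhoOf (aRec n)| ≠ 0 := abs_ne_zero.2 (rhoOf_aRec_ne_zero n)
  have hdiv : rhoOf (aRec n) / |rhoOf (aRec n)| = s := by rw [div_eq_iff habs]; exact hρ
  have key : M0 n * recordP n = (rhoOf (aRec n) / |rhoOf (aRec n)|) *
      ((dRec n ^ 3 * sharpNormaliser (bRecord' n) * coeffW (bRecord' n)) *
      (dRec n ^ 6 * sharpNormaliser (bRecord n) * coeffV (bRecord n)) -
      (dRec n ^ 3 * sharpNormaliser (bRecord n) * coeffW (bRecord n)) *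
      (dRec n ^ 6 * sharpNormaliser (bRecord' n) * coeffV (bRecord' n))) := by
    unfold M0 recordP
    field_simp
  rw [hdiv, hzW, hzV, hzW', hzV'] at key
  have hdvd : ((corrX n : ℕ) : ℤ) ∣ (zW' * zV - zW * zV') := by
    apply multiWindowProd_dvd_int
    · intro i hi p hp
      exact ((windowsX_dvd hn hzW hzV hzW' hzV' hzU hzU') i hi p hp).1
    · exact windowsX_disjoint n
  obtain ⟨q, hq⟩ := hdvd
  refine ⟨s * q, ?_⟩
  have hc : (corrX n : ℚ) ≠ 0 := by exact_mod_cast (corrX_pos n).ne'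
  have e : (zW' : ℚ) * zV - zW * zV' = (corrX n : ℚ) * q := by exact_mod_cast hq
  calc MX n * recordP n = M0 n * recordP n / corrX n := by unfold MX; ring
    _ = s * ((zW' : ℚ) * zV - zW * zV') / corrX n := by rw [key]
    _ = ((s * q : ℤ) : ℚ) := by rw [e]; push_cast; field_simp

/-- **`MX n · Q(a·n) ∈ ℤ`** (`n ≥ 42`). -/
theorem MX_mul_recordQ_int {n : ℕ} (hn : 42 ≤ n) : ∃ z : ℤ, MX n * recordQ n = z := by
  classical
  have hn1 : 1 ≤ n := by omega
  obtain ⟨⟨zU, hzU⟩, ⟨zW, hzW⟩, ⟨zV, hzV⟩, ⟨zU', hzU'⟩, ⟨zW', hzW'⟩, ⟨zV', hzV'⟩⟩ := sharp_ints hn1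
  obtain ⟨s, -, hρ⟩ := exists_sign_mul_abs _ (rhoOf_aRec_ne_zero n)
  have habs : |rhoOf (aRec n)| ≠ 0 := abs_ne_zero.2 (rhoOf_aRec_ne_zero n)
  have hdiv : rhoOf (aRec n) / |rhoOf (aRec n)| = s := by rw [div_eq_iff habs]; exact hρ
  have hQ := recordQ_eq_wedge hn1
  have key : M0 n * recordQ n = (rhoOf (aRec n) / |rhoOf (aRec n)|) * dRec n ^ 5 *
      ((dRec n * sharpNormaliser (bRecord n) * coeffU (bRecord n)) *
      (dRec n ^ 3 * sharpNormaliser (bRecord' n) * coeffW (bRecord' n)) -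
      (dRec n * sharpNormaliser (bRecord' n) * coeffU (bRecord' n)) *
      (dRec n ^ 3 * sharpNormaliser (bRecord n) * coeffW (bRecord n))) := by
    unfold M0
    rw [hQ]
    field_simp
  rw [hdiv, hzU, hzW, hzU', hzW'] at key
  set D : ℤ := (Nat.lcmUpto (41 * n) : ℤ) with hD
  have hdvd : ((corrX n : ℕ) : ℤ) ∣ (D ^ 5 * (zU * zW') - D ^ 5 * (zU' * zW)) := by
    apply multiWindowProd_dvd_int
    · intro i hi p hp
      exact ((windowsX_dvd hn hzW hzV hzW' hzV' hzU hzU') i hi p hp).2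
    · exact windowsX_disjoint n
  obtain ⟨q, hq⟩ := hdvd
  refine ⟨s * q, ?_⟩
  have hc : (corrX n : ℚ) ≠ 0 := by exact_mod_cast (corrX_pos n).ne'
  have hDq : (D : ℚ) = dRec n := by rw [hD]; unfold dRec; push_cast; rfl
  have e : (dRec n) ^ 5 * ((zU : ℚ) * zW' - zU' * zW) = (corrX n : ℚ) * q := by
    rw [← hDq]; exact_mod_cast (by rw [← hq]; ring : D ^ 5 * (zU * zW' - zU' * zW) = (corrX n : ℤ) * q)
  calc MX n * recordQ n = M0 n * recordQ n / corrX n := by unfold MX; ring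
    _ = s * (dRec n ^ 5 * ((zU : ℚ) * zW' - zU' * zW)) / corrX n := by rw [key]; ring
    _ = ((s * q : ℤ) : ℚ) := by rw [e]; push_cast; field_simp

/-- **Size**: for every `ε > 0`, eventually `MX n ≤ e^{(125.9764 + ε)·n}` (`381.5232 − 255.5468`). -/
theorem eventually_MX_le_exp {ε : ℝ} (hε : 0 < ε) :
    ∀ᶠ n : ℕ in atTop, ((MX n : ℚ) : ℝ) ≤ Real.exp (((3815232 / 10000 - 398653 / 1560 : ℚ) + ε) * n) := by
  have hε2 : 0 < ε / 2 := by positivity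
  have hΦ := eventually_exp_le_multiWindowProd (s := (Finset.univ : Finset (Fin 24))) (w := wQx) AwinX_le_BwinX hε2
  filter_upwards [eventually_M0_le_exp hε2, hΦ] with n hM0 hcorr
  rw [window_rateX] at hcorr
  have hcorr' : Real.exp ((398653 / 1560 - ε / 2) * n) ≤ ((corrX n : ℕ) : ℝ) := hcorr
  have hcpos : (0 : ℝ) < ((corrX n : ℕ) : ℝ) := by exact_mod_cast corrX_pos n
  have hcast : ((MX n : ℚ) : ℝ) = ((M0 n : ℚ) : ℝ) / ((corrX n : ℕ) : ℝ) := by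
    unfold MX; push_cast; rfl
  rw [hcast]
  calc ((M0 n : ℚ) : ℝ) / ((corrX n : ℕ) : ℝ) ≤ Real.exp ((3815232 / 10000 + ε / 2) * n) / ((corrX n : ℕ) : ℝ) :=
        div_le_div_of_nonneg_right hM0 hcpos.le
    _ ≤ Real.exp ((3815232 / 10000 + ε / 2) * n) / Real.exp ((398653 / 1560 - ε / 2) * n) :=
        div_le_div_of_nonneg_left (Real.exp_pos _).le (Real.exp_pos _) hcorr'
    _ = Real.exp (((3815232 / 10000 - 398653 / 1560 : ℚ) + ε) * n) := by rw [← Real.exp_sub]; push_cast; ring_nf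

/-- **THE EXPONENT `0.5525`, hypothesis-free.**  For every `0 ≤ γ ≤ 0.5525`, eventually
`|ζ(5) − P_n/Q(a·n)| < 1/q_n^γ` with the integers `p_n = MX n·P_n`, `q_n = MX n·|Q(a·n)| ≥ 1`.
Arithmetic: `0.5525·(125.9764 + 0.02 + 85.08768884) < 85.08768883 + 31.5452`.  No irrationality content (`γ < 1`). -/
theorem record_exponent_lawW {γ : ℝ} (hγ0 : 0 ≤ γ) (hγ : γ ≤ 5525 / 10000) :
    ∀ᶠ n : ℕ in atTop, ∃ p : ℤ, ∃ q : ℕ, 1 ≤ q ∧ (q : ℚ) = MX n * |(recordQ n : ℚ)| ∧ (p : ℚ) = MX n * recordP n ∧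
      |zetaValue 5 - (recordP n : ℝ) / (recordQ n : ℝ)| < 1 / (q : ℝ) ^ γ := by
  refine record_exponent_rat (lam := ((3815232 / 10000 - 398653 / 1560 : ℚ) : ℝ) + 2 / 100) MX ?_ hγ0 (by push_cast; nlinarith)
  filter_upwards [eventually_MX_le_exp (show (0 : ℝ) < 2 / 100 by norm_num), eventually_ge_atTop 42] with n hn hn42
  exact ⟨MX_pos n, MX_mul_recordP_int hn42, MX_mul_recordQ_int hn42, hn⟩

end Summit.KontsevichZagierPeriods.Zeta5Search.RecordRay
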